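import Summits.AtomisticToContinuum.Crystallization.Theorems.FrustratedLawDichotomyCellF1cHostLinTable
import Summits.AtomisticToContinuum.Crystallization.Theorems.FrustratedLawDichotomyCellF1HostLin

/-!
# FrustratedLawDichotomy · crux `AperiodicFrustratedLawGap` (stmt-AtomisticToContinuum-27623) — class-A K-file tower, layer 5c (column) over the
COMPLETE template `MF1c`: the F1 HOST COLUMN, EDITION 3 (KFILE amendments E2/E3/E4, critic r1861; (L1) «CellHostTaylor» r1856 (B)/r1859 (A); hand-2 g48)

#105 `…CellF1HostLin` RE-BASED on the complete-template label set #106 `MF1c` and the 903-class table `…CellF1cHostLinTable`: the generic pieces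
(`gram_one_aF1`, `aF1_apply`, `Td`, `ell_eq`, `lZ`) are #105's (imported); everything indexed by the label set is re-stated over `MF1c ∖ 0`:
named columns `kRc/dRc/qRc`, `hostLc F`, the label-wise facts `hk_F1c`/`hd_F1c`/`hq_F1c`/`hρ_F1c`, ★ `hhost_F1cL` (the master's `hhost`), the ONE-PASS
twelve integer folds `foldsLc_eq` + unpacking, the virial / `ℓ` identities, and ★★ `hostLin_sum_gec : (H3c : ℝ) ≤ Σ_{m ∈ MF1c∖0} hostLc F m` on the metric
box `|FᵀF − 1| ≤ 2⁻¹⁰`, with the LITERALS OF RECORD (r1861 (B), census HOSTTAYLOR56b_F1.json, class-wise q): Σk = −6 077 531 634, Σq = 647 852,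
16384²·Σℓ = 877 608 648 719 088 (Σℓ = 3 269 346.98), s = diag(−1 472 004 592, 577 907 252, 577 907 252), off-diagonal folds 0 EXACTLY,
`H3c = −208884706752265105905/2⁶⁷ = −1.4154578` FULL (`−0.7077289` per root; rule-(b) cost vs `MF1`: −1.5·10⁻⁶ per root ✓ r1861 (B)).
Imports TREE `…CellF1cHostLinTable` + #105 `…CellF1HostLin`; 0 sorry.  Tags: [new: K-file certificates]; nothing here closes an item.
-/

namespace Summit.AtomisticToContinuum.Crystallization.Theorems.FrustratedLawDichotomyCellF1cHostLin

open scoped BigOperators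
open Summit.AtomisticToContinuum.Crystallization.Theorems.FrustratedLawDichotomyCellBST
open Summit.AtomisticToContinuum.Crystallization.Theorems.FrustratedLawDichotomyCoherentFloorAlgebra (phiT phiT1)
open Summit.AtomisticToContinuum.Crystallization.Theorems.FrustratedLawDichotomyCellMetric (posL gram)
open Summit.AtomisticToContinuum.Crystallization.Theorems.FrustratedLawDichotomyCellTriples (zT)
open Summit.AtomisticToContinuum.Crystallization.Theorems.FrustratedLawDichotomyCellF1Frame (qk T TQ)
open Summit.AtomisticToContinuum.Crystallization.Theorems.FrustratedLawDichotomyCellF1Labels (qkF qkF_eq)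
open Summit.AtomisticToContinuum.Crystallization.Theorems.FrustratedLawDichotomyCellF1cLabels (labF1c' MF1c erase_MF1c_eq labF1c'_nodup)
open Summit.AtomisticToContinuum.Crystallization.Theorems.FrustratedLawDichotomyCellF1Pos (aF1 aF1_eq sumSq_aF1)
open Summit.AtomisticToContinuum.Crystallization.Theorems.FrustratedLawDichotomyCellF1HostTable (phiQ phiQ_cast)
open Summit.AtomisticToContinuum.Crystallization.Theorems.FrustratedLawDichotomyCellF1HostLinTable (tQ pL pL_sound)
open Summit.AtomisticToContinuum.Crystallization.Theorems.FrustratedLawDichotomyCellF1cHostLinTable (treeLc treeLc_ok treeLc_hits)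
open Summit.AtomisticToContinuum.Crystallization.Theorems.FrustratedLawDichotomyCellF1HostLin (gram_one_aF1 lZ Td Td_pos aF1_apply ell_eq)
open Summit.AtomisticToContinuum.Crystallization.Theorems.FrustratedLawDichotomyCellHostTaylor
  (gram_one_self gram_one_sub_pos second_order_le_classwise phiT_posL_ge sum_hostLin_ge_of_readings)

/-! ## §3 The named columns and the label-wise facts -/

/-- the leaf of a label (misses ↦ `0`; there are none on `MF1c ∖ 0`). -/
def leafLc (m : ℤ × ℤ × ℤ) : ℤ × ℤ × ℤ := treeLc.findD (qkF m) 0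

/-- the integer point reading `k_{c(m)}`. -/
def kLc (m : ℤ × ℤ × ℤ) : ℤ := (leafLc m).1

/-- the integer slope reading `d_{c(m)}`. -/
def dLc (m : ℤ × ℤ × ℤ) : ℤ := (leafLc m).2.1

/-- the integer second-order reading `q_{c(m)}`. -/
def cLc (m : ℤ × ℤ × ℤ) : ℤ := (leafLc m).2.2

/-- ★ NAMED column (G5): `kRc m = k_{c(m)}/2³²`. -/
noncomputable def kRc (m : ℤ × ℤ × ℤ) : ℝ := (kLc m : ℝ) / 2 ^ 32

/-- ★ NAMED column (G5): `dRc m = d_{c(m)}/2³²`. -/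
noncomputable def dRc (m : ℤ × ℤ × ℤ) : ℝ := (dLc m : ℝ) / 2 ^ 32

/-- ★ NAMED column (G5): `qRc m = q_{c(m)}/2³²`. -/
noncomputable def qRc (m : ℤ × ℤ × ℤ) : ℝ := (cLc m : ℝ) / 2 ^ 32

/-- ★ THE EDITION-3 HOST of a label under the strain `F`: `φ(t⁰) + φ′(t⁰)·gram (FᵀF − 1) a a − q`. -/
noncomputable def hostLc (F : Matrix (Fin 3) (Fin 3) ℝ) (m : ℤ × ℤ × ℤ) : ℝ :=
  phiT (gram 1 (aF1 m) (aF1 m)) + phiT1 (gram 1 (aF1 m) (aF1 m)) * gram (F.transpose * F - 1) (aF1 m) (aF1 m) - qRc m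

/-- on a non-root label the leaf passes the test. -/
theorem leaf_okc {m : ℤ × ℤ × ℤ} (hm : m ∈ MF1c.erase 0) : pL (qkF m) (leafLc m) = true := by
  rw [erase_MF1c_eq, List.mem_toFinset] at hm
  exact BT.all_findD treeLc_ok (treeLc_hits m hm) 0

/-- `hk`: the point reading is below `φ(t⁰)`. -/
theorem hk_F1c : ∀ m ∈ MF1c.erase 0, kRc m ≤ phiT (gram 1 (aF1 m) (aF1 m)) := fun m hm => by
  rw [gram_one_aF1]; exact (pL_sound (leaf_okc hm)).2.1

/-- `hd`: the slope reading is within `2⁻³³` of `φ′(t⁰)`. -/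
theorem hd_F1c : ∀ m ∈ MF1c.erase 0, |dRc m - phiT1 (gram 1 (aF1 m) (aF1 m))| ≤ 1 / 2 ^ 33 := fun m hm => by
  rw [gram_one_aF1]; exact (pL_sound (leaf_okc hm)).2.2.1

/-- the template scalar is positive on non-root labels. -/
theorem gram_pos_F1c {m : ℤ × ℤ × ℤ} (hm : m ∈ MF1c.erase 0) : 0 < gram 1 (aF1 m) (aF1 m) := by
  rw [gram_one_aF1]; exact (pL_sound (leaf_okc hm)).1

/-- `hρ`: the label-wise second-order window is non-degenerate (`3ε < 1`). -/
theorem hρ_F1c {m : ℤ × ℤ × ℤ} (hm : m ∈ MF1c.erase 0) : 0 < gram 1 (aF1 m) (aF1 m) - 1 / 1024 * (∑ i, |aF1 m i|) ^ 2 :=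
  gram_one_sub_pos (by norm_num) (by norm_num) (gram_pos_F1c hm)

/-- `hq`: the label-wise second-order term is below the class reading (via the class-wise bound `ℓ ≤ 3t⁰`). -/
theorem hq_F1c {m : ℤ × ℤ × ℤ} (hm : m ∈ MF1c.erase 0) :
    (gram 1 (aF1 m) (aF1 m) - 1 / 1024 * (∑ i, |aF1 m i|) ^ 2)⁻¹ ^ 5 * (1 / 1024 * (∑ i, |aF1 m i|) ^ 2) ^ 2 ≤ qRc m := by
  refine (second_order_le_classwise (by norm_num) (by norm_num) (gram_pos_F1c hm)).trans ?_
  rw [gram_one_aF1]; exact (pL_sound (leaf_okc hm)).2.2.2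

/-- ★ LABEL-WISE CERTIFICATION of the edition-3 host (the master's `hhost` binder): under every `F` of the metric box, `hostLc F m ≤ φ(‖posL F (aF1 m)‖²)`. -/
theorem hhost_F1cL {F : Matrix (Fin 3) (Fin 3) ℝ} (hG : ∀ i j, |(F.transpose * F) i j - (if i = j then 1 else 0)| ≤ 1 / 1024) :
    ∀ m ∈ MF1c.erase 0, hostLc F m ≤ phiT (‖posL F (aF1 m)‖ ^ 2) :=
  fun m hm => phiT_posL_ge hG (aF1 m) (hρ_F1c hm) (hq_F1c hm)

/-! ## §4 The one pass: twelve integer folds -/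

/-- one step of the accumulator `[K, Q, L, s₀₀, s₀₁, s₀₂, s₁₀, s₁₁, s₁₂, s₂₀, s₂₁, s₂₂]` (a 12-list; any other shape is left alone). -/
def accStepc (p : List ℤ) (m : ℤ × ℤ × ℤ) : List ℤ :=
  match p with
  | [K, Q, L, s00, s01, s02, s10, s11, s12, s20, s21, s22] =>
    [K + kLc m, Q + cLc m, L + lZ m, s00 + dLc m * (zT m 0 * zT m 0), s01 + dLc m * (zT m 0 * zT m 1), s02 + dLc m * (zT m 0 * zT m 2),
      s10 + dLc m * (zT m 1 * zT m 0), s11 + dLc m * (zT m 1 * zT m 1), s12 + dLc m * (zT m 1 * zT m 2),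
      s20 + dLc m * (zT m 2 * zT m 0), s21 + dLc m * (zT m 2 * zT m 1), s22 + dLc m * (zT m 2 * zT m 2)]
  | l => l

/-- the folds over the non-root labels, in ONE pass. -/
def foldsLc : List ℤ := labF1c'.foldl accStepc [0, 0, 0, 0, 0, 0, 0, 0, 0, 0, 0, 0]

/-- ★ KERNEL FACT 3: the twelve folds (`Σk, Σq, 16384²Σℓ, s_ij`). -/
theorem foldsLc_eq : foldsLc = [(-6077531634), 647852, 877608648719088, (-1472004592), 0, 0, 0, 577907252, 0, 0, 0, 577907252] := by
  decide +kernel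

/-- the virial fold of the pair `(i, j)`. -/
def sLc (i j : Fin 3) : ℤ := (labF1c'.map fun m => dLc m * (zT m i * zT m j)).sum

/-- unpacking the accumulator: each slot is the corresponding list sum. -/
theorem foldl_accStepc (l : List (ℤ × ℤ × ℤ)) (K Q L s00 s01 s02 s10 s11 s12 s20 s21 s22 : ℤ) :
    l.foldl accStepc [K, Q, L, s00, s01, s02, s10, s11, s12, s20, s21, s22] =
      [K + (l.map kLc).sum, Q + (l.map cLc).sum, L + (l.map lZ).sum,
        s00 + (l.map fun m => dLc m * (zT m 0 * zT m 0)).sum, s01 + (l.map fun m => dLc m * (zT m 0 * zT m 1)).sum,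
        s02 + (l.map fun m => dLc m * (zT m 0 * zT m 2)).sum, s10 + (l.map fun m => dLc m * (zT m 1 * zT m 0)).sum,
        s11 + (l.map fun m => dLc m * (zT m 1 * zT m 1)).sum, s12 + (l.map fun m => dLc m * (zT m 1 * zT m 2)).sum,
        s20 + (l.map fun m => dLc m * (zT m 2 * zT m 0)).sum, s21 + (l.map fun m => dLc m * (zT m 2 * zT m 1)).sum,
        s22 + (l.map fun m => dLc m * (zT m 2 * zT m 2)).sum] := by
  induction l generalizing K Q L s00 s01 s02 s10 s11 s12 s20 s21 s22 with
  | nil => simp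
  | cons m l ih => simp only [List.foldl_cons, accStepc, ih, List.map_cons, List.sum_cons, add_assoc]

/-- the three scalar folds and the nine virial folds, read off KERNEL FACT 3. -/
theorem folds_readc : (labF1c'.map kLc).sum = (-6077531634) ∧ (labF1c'.map cLc).sum = 647852 ∧ (labF1c'.map lZ).sum = 877608648719088 ∧
    sLc 0 0 = (-1472004592) ∧ sLc 0 1 = 0 ∧ sLc 0 2 = 0 ∧ sLc 1 0 = 0 ∧ sLc 1 1 = 577907252 ∧ sLc 1 2 = 0 ∧
    sLc 2 0 = 0 ∧ sLc 2 1 = 0 ∧ sLc 2 2 = 577907252 := by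
  have h := foldsLc_eq
  rw [foldsLc, foldl_accStepc] at h
  simp only [zero_add, List.cons.injEq, and_true] at h
  exact h

/-! ## §5 The real identities and the literal -/

/-- `MF1c ∖ 0`-sums of an integer column are the list folds, cast. -/
theorem sum_cast_eqc (f : ℤ × ℤ × ℤ → ℤ) : ∑ m ∈ MF1c.erase 0, (f m : ℝ) = (((labF1c'.map f).sum : ℤ) : ℝ) := by
  rw [erase_MF1c_eq, List.sum_toFinset _ labF1c'_nodup, Int.cast_list_sum, List.map_map]; rfl

/-- Σ kRc. -/
theorem sum_kRc : ∑ m ∈ MF1c.erase 0, kRc m = (((-6077531634) : ℤ) : ℝ) / 2 ^ 32 := by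
  have h : ∑ m ∈ MF1c.erase 0, kRc m = (∑ m ∈ MF1c.erase 0, (kLc m : ℝ)) / 2 ^ 32 := by rw [Finset.sum_div]; rfl
  rw [h, sum_cast_eqc, folds_readc.1]

/-- Σ qRc. -/
theorem sum_qRc : ∑ m ∈ MF1c.erase 0, qRc m = ((647852 : ℤ) : ℝ) / 2 ^ 32 := by
  have h : ∑ m ∈ MF1c.erase 0, qRc m = (∑ m ∈ MF1c.erase 0, (cLc m : ℝ)) / 2 ^ 32 := by rw [Finset.sum_div]; rfl
  rw [h, sum_cast_eqc, folds_readc.2.1]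

/-- the virial entry of the pair `(i, j)`: `Σ_m dRc m·a_mi·a_mj = T_ii T_jj s_ij / 2³²`. -/
theorem virial_entryc (i j : Fin 3) : ∑ m ∈ MF1c.erase 0, dRc m * (aF1 m i * aF1 m j) = Td i * Td j / 2 ^ 32 * (sLc i j : ℝ) := by
  have h : ∀ m, dRc m * (aF1 m i * aF1 m j) = Td i * Td j / 2 ^ 32 * ((dLc m * (zT m i * zT m j) : ℤ) : ℝ) := by
    intro m; rw [aF1_apply, aF1_apply]; unfold dRc; push_cast; ring
  simp_rw [h]
  rw [← Finset.mul_sum, sum_cast_eqc]; rfl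

/-- the absolute virial entry: `|Σ_m dRc m·a_mi·a_mj| = T_ii T_jj |s_ij| / 2³²`. -/
theorem abs_virial_entryc (i j : Fin 3) : |∑ m ∈ MF1c.erase 0, dRc m * (aF1 m i * aF1 m j)| = Td i * Td j / 2 ^ 32 * ((|sLc i j| : ℤ) : ℝ) := by
  rw [virial_entryc, abs_mul, abs_of_pos (by have := Td_pos i; have := Td_pos j; positivity), Int.cast_abs]

/-- the first-order (virial) column, in closed form (the six off-diagonal folds vanish; `T₁ = T₂`). -/
theorem virial_sum_eqc : ∑ i, ∑ j, |∑ m ∈ MF1c.erase 0, dRc m * (aF1 m i * aF1 m j)| =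
    ((10477 / 16384 : ℝ) * (10477 / 16384) * 1472004592 + 2 * ((11706 / 16384 : ℝ) * (11706 / 16384) * 577907252)) / 2 ^ 32 := by
  simp_rw [abs_virial_entryc]
  obtain ⟨-, -, -, h00, h01, h02, h10, h11, h12, h20, h21, h22⟩ := folds_readc
  simp only [Fin.sum_univ_three, h00, h01, h02, h10, h11, h12, h20, h21, h22, Td]
  simp only [Matrix.cons_val_zero, Matrix.cons_val_one, Matrix.head_cons, Matrix.cons_val_two, Matrix.tail_cons]
  norm_num

/-- Σ ℓ. -/
theorem sum_ellc : ∑ m ∈ MF1c.erase 0, (∑ i, |aF1 m i|) ^ 2 = ((877608648719088 : ℤ) : ℝ) / 16384 ^ 2 := by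
  simp_rw [ell_eq]
  rw [← Finset.sum_div, sum_cast_eqc, folds_readc.2.2.1]

/-- ★ THE LITERAL `H3c` of the edition-3 host column (exact rational; `= -1.4154578…` FULL, `-0.7077289…` per root). -/
def H3c : ℚ := (-208884706752265105905) / 147573952589676412928

/-- ★★ **THE F1 HOST COLUMN, EDITION 3**: on the metric box `|FᵀF − 1| ≤ 2⁻¹⁰`, `H3c ≤ Σ_{m ∈ MF1c∖0} hostLc F m` (the master's `hH` binder with
`host := hostLc F`, `hhost := hhost_F1cL hG`). -/
theorem hostLin_sum_gec {F : Matrix (Fin 3) (Fin 3) ℝ} (hG : ∀ i j, |(F.transpose * F) i j - (if i = j then 1 else 0)| ≤ 1 / 1024) :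
    ((H3c : ℚ) : ℝ) ≤ ∑ m ∈ MF1c.erase 0, hostLc F m := by
  have h := sum_hostLin_ge_of_readings (MF1c.erase 0) aF1 (ε := 1 / 1024) (η := 1 / 2 ^ 33) (by norm_num) hG kRc dRc qRc hk_F1c hd_F1c
  rw [sum_kRc, virial_sum_eqc, sum_ellc, sum_qRc] at h
  refine le_trans ?_ h
  unfold H3c
  push_cast
  norm_num

end Summit.AtomisticToContinuum.Crystallization.Theorems.FrustratedLawDichotomyCellF1cHostLin
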